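import Summits.KontsevichZagierPeriods.KontsevichZagierPeriods.Theorems.RootDecompRelativeModAbsoluteRegKernelPairLeOneP12
/-! # `RegKernelPairDegOne` (stmt-30572), COMMON-`κ₀ > 0` rung with both kinds — `regKernelPairDegOne_of_commonPos` (lens-3 g9 §18, Bands v6 @720470ba; critic CLEARED 2026-08-30T11:21:02Z).
Second half of the lens part 12 (split by the landing seat decomp-kz-census-1 g7 for the 400-line policy); `--supports stmt-KontsevichZagierPeriods-30572`; uses `isSemialgebraicFunOn_finset_sum` of the landed `…CylKernelZero` module. No `sorry`; standard axioms. [cite: KontsevichZagier2001, §1.2] -/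
noncomputable section
open Set MeasureTheory Filter Topology Literature.NumberTheory.Transcendental Literature.ModelTheory.ExponentialFields
open scoped BigOperators
namespace Summit.KontsevichZagierPeriods.RootDecompRelativeModAbsolute.Rung30571
namespace RegularisedLogLayer
section CommonPosRung
/-- (PRIVATE copy; the landed twins are private/unbuilt.) Finite sums of `ℚ`-semialgebraic functions. [BCR 1998, Prop. 2.2.6] -/
private theorem isSemialgebraicFunOn_finset_sum {n : ℕ} {s : Set (Fin n → ℝ)} (hs : IsSemialgebraic ℚ s) {ι : Type*} (I : Finset ι) {f : ι → (Fin n → ℝ) → ℝ} (hf : ∀ i ∈ I, IsSemialgebraicFunOn ℚ s (f i)) : IsSemialgebraicFunOn ℚ s (fun x => ∑ i ∈ I, f i x) := by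
  classical
  induction I using Finset.induction_on with
  | empty => exact (isSemialgebraicFunOn_ratCast hs 0).congr fun x _ => by simp
  | insert a I ha ih =>
    have h1 : IsSemialgebraicFunOn ℚ s (f a) := hf a (Finset.mem_insert_self a I)
    have h2 := ih fun i hi => hf i (Finset.mem_insert_of_mem hi)
    refine (IsSemialgebraicFunOn.add_holds h1 h2).congr fun x _ => ?_
    simp only [Pi.add_apply, Finset.sum_insert ha]
/-- **Item 30572 `RegKernelPairDegOne`, COMMON-`κ₀ > 0` case, BOTH KINDS — PROVED** (verbatim binders + one common argument function `κ₀ > 0`, ℚ-semialgebraic on `G ∪ G'`; lens-3 g9 §18). -/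
theorem regKernelPairDegOne_of_commonPos :
    ∀ (g g' : Literature.NumberTheory.Transcendental.KZ.IntegralRep 1) (k k' : ℕ) (h κ : Fin k → (Fin 1 → ℝ) → ℝ) (M e : Fin k → ℕ) (U : Fin k → Literature.NumberTheory.Transcendental.KZ.IntegralRep (1 + 1)) (h' κ' : Fin k' → (Fin 1 → ℝ) → ℝ) (M' e' : Fin k' → ℕ) (U' : Fin k' → Literature.NumberTheory.Transcendental.KZ.IntegralRep (1 + 1)), ∀ κ₀ : (Fin 1 → ℝ) → ℝ, Literature.NumberTheory.Transcendental.IsSemialgebraicFunOn ℚ (g.domain ∪ g'.domain) κ₀ → (∀ x ∈ g.domain ∪ g'.domain, 0 < κ₀ x) → (∀ i, κ i = κ₀) → (∀ j, κ' j = κ₀) → (∀ i, Literature.NumberTheory.Transcendental.IsSemialgebraicFunOn ℚ g.domain (h i)) → (∀ i, Literature.NumberTheory.Transcendental.IsSemialgebraicFunOn ℚ g.domain (κ i)) → (∀ i, e i = 1 ∨ e i = 2) → (∀ i, ∀ x ∈ g.domain, -1 < κ i x) → (∀ i, (U i).domain = {z : Fin (1 + 1) → ℝ | (Fin.init z : Fin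 1 → ℝ) ∈ g.domain ∧ z (Fin.last 1) ∈ Set.Ioo 0 1}) → (∀ i, Set.EqOn (U i).integrand (fun z => h i (Fin.init z) * (z (Fin.last 1) ^ M i / (1 + z (Fin.last 1) ^ e i * κ i (Fin.init z)))) (U i).domain) → (∀ i, MeasureTheory.IntegrableOn (fun x => h i x * ∫ θ in Set.Ioo (0 : ℝ) 1, θ ^ M i / (1 + θ ^ e i * κ i x)) g.domain) → (∀ j, Literature.NumberTheory.Transcendental.IsSemialgebraicFunOn ℚ g'.domain (h' j)) → (∀ j, Literature.NumberTheory.Transcendental.IsSemialgebraicFunOn ℚ g'.domain (κ' j)) → (∀ j, e' j = 1 ∨ e' j = 2) → (∀ j, ∀ x ∈ g'.domain, -1 < κ' j x) → (∀ j, (U' j).domain = {z : Fin (1 + 1) → ℝ | (Fin.init z : Fin 1 → ℝ) ∈ g'.domain ∧ z (Fin.last 1) ∈ Set.Ioo 0 1}) → (∀ j, Set.EqOn (U' j).integrand (fun z => h' j (Fin.init z) * (z (Fin.last 1) ^ M' j / (1 + z (Fin.last 1) ^ e' j * κ' j (Fin.init z)))) (U' j).domain) → (∀ j, MeasureTheory.IntegrableOn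 (fun x => h' j x * ∫ θ in Set.Ioo (0 : ℝ) 1, θ ^ M' j / (1 + θ ^ e' j * κ' j x)) g'.domain) → (∀ᵐ x : (Fin 1 → ℝ), g.domain.indicator (fun x => g.integrand x + ∑ i, h i x * ∫ θ in Set.Ioo (0 : ℝ) 1, θ ^ M i / (1 + θ ^ e i * κ i x)) x = g'.domain.indicator (fun x => g'.integrand x + ∑ j, h' j x * ∫ θ in Set.Ioo (0 : ℝ) 1, θ ^ M' j / (1 + θ ^ e' j * κ' j x)) x) → (Literature.NumberTheory.Transcendental.KZ.of g + ∑ i, Literature.NumberTheory.Transcendental.KZ.of (U i)) - (Literature.NumberTheory.Transcendental.KZ.of g' + ∑ j, Literature.NumberTheory.Transcendental.KZ.of (U' j)) ∈ Literature.NumberTheory.Transcendental.KZ.relations := by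

  intro g g' k k' h κ M e U h' κ' M' e' U' κ₀ hκ₀s hκ₀0 hκκ hκκ' hh hκs hem hκ1 hdom hint hL1
    hh' hκs' hem' hκ1' hdom' hint' hL1' hae
  classical
  -- the pieces of the bases
  have hG : IsSemialgebraic ℚ g.domain := g.isSemialgebraic_domain
  have hG' : IsSemialgebraic ℚ g'.domain := g'.isSemialgebraic_domain
  have hIs : IsSemialgebraic ℚ (g.domain ∩ g'.domain) := hG.inter hG'
  have hDs : IsSemialgebraic ℚ (g.domain \ g'.domain) := hG.diff hG'
  have hD's : IsSemialgebraic ℚ (g'.domain \ g.domain) := hG'.diff hG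
  have hκ₀G : IsSemialgebraicFunOn ℚ g.domain κ₀ := hκ₀s.mono subset_union_left hG
  have hκ₀G' : IsSemialgebraicFunOn ℚ g'.domain κ₀ := hκ₀s.mono subset_union_right hG'
  -- a bound for the orders; the regrouped coefficient functions (by order and kind)
  set n : ℕ := ∑ i, M i + ∑ j, M' j with hn_def
  have hMn : ∀ i, M i ≤ n := fun i =>
    (Finset.single_le_sum (f := M) (fun i _ => Nat.zero_le _) (Finset.mem_univ i)).trans
      (Nat.le_add_right _ _)
  have hM'n : ∀ j, M' j ≤ n := fun j =>
    (Finset.single_le_sum (f := M') (fun j _ => Nat.zero_le _) (Finset.mem_univ j)).trans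
      (Nat.le_add_left _ _)
  have hMn2 : ∀ i, M i ≤ 2 * n + 1 := fun i => (hMn i).trans (by omega)
  have hM'n2 : ∀ j, M' j ≤ 2 * n + 1 := fun j => (hM'n j).trans (by omega)
  set cL : ℕ → (Fin 1 → ℝ) → ℝ := fun m x =>
    ∑ i, if M i = m then (if e i = 1 then h i x else 0) else 0 with hcL_def
  set cA : ℕ → (Fin 1 → ℝ) → ℝ := fun m x =>
    ∑ i, if M i = m then (if e i = 2 then h i x else 0) else 0 with hcA_def
  set cL' : ℕ → (Fin 1 → ℝ) → ℝ := fun m x =>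
    ∑ j, if M' j = m then (if e' j = 1 then h' j x else 0) else 0 with hcL'_def
  set cA' : ℕ → (Fin 1 → ℝ) → ℝ := fun m x =>
    ∑ j, if M' j = m then (if e' j = 2 then h' j x else 0) else 0 with hcA'_def
  have hcoef : ∀ {S : Set (Fin 1 → ℝ)} (hS : IsSemialgebraic ℚ S) {q : ℕ} (N E : Fin q → ℕ)
      (u : Fin q → (Fin 1 → ℝ) → ℝ) (hu : ∀ i, IsSemialgebraicFunOn ℚ S (u i)) (m d : ℕ),
      IsSemialgebraicFunOn ℚ S
        (fun x => ∑ i, if N i = m then (if E i = d then u i x else 0) else 0) := by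
    intro S hS q N E u hu m d
    refine isSemialgebraicFunOn_finset_sum hS _ fun i _ => ?_
    by_cases hi : N i = m
    · by_cases hei : E i = d
      · simp only [hi, hei, if_true]; exact hu i
      · simp only [hi, hei, if_true, if_false]
        exact (isSemialgebraicFunOn_ratCast hS 0).congr fun x _ => by simp
    · simp only [hi, if_false]
      exact (isSemialgebraicFunOn_ratCast hS 0).congr fun x _ => by simp
  have hcL : ∀ m, IsSemialgebraicFunOn ℚ g.domain (cL m) := fun m => hcoef hG M e h hh m 1
  have hcA : ∀ m, IsSemialgebraicFunOn ℚ g.domain (cA m) := fun m => hcoef hG M e h hh m 2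
  have hcL' : ∀ m, IsSemialgebraicFunOn ℚ g'.domain (cL' m) := fun m => hcoef hG' M' e' h' hh' m 1
  have hcA' : ∀ m, IsSemialgebraicFunOn ℚ g'.domain (cA' m) := fun m => hcoef hG' M' e' h' hh' m 2
  -- the collapsed integrands and their regrouped forms
  set FU : (Fin (1 + 1) → ℝ) → ℝ := fun z =>
    ∑ i, h i (Fin.init z) * kernel (M i) (e i) (κ₀ (Fin.init z)) (z (Fin.last 1)) with hFU_def
  set FU' : (Fin (1 + 1) → ℝ) → ℝ := fun z =>
    ∑ j, h' j (Fin.init z) * kernel (M' j) (e' j) (κ₀ (Fin.init z)) (z (Fin.last 1)) with hFU'_def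
  have hFU : ∀ z, FU z =
      ∑ m ∈ Finset.range (n + 1), cL m (Fin.init z) * kernel m 1 (κ₀ (Fin.init z)) (z (Fin.last 1)) +
      ∑ m ∈ Finset.range (2 * n + 2),
        cA m (Fin.init z) * kernel m 2 (κ₀ (Fin.init z)) (z (Fin.last 1)) := fun z => by
    simp only [hFU_def, hcL_def, hcA_def]
    exact sum_regroup₂ M e (fun i => h i (Fin.init z))
      (fun m d => kernel m d (κ₀ (Fin.init z)) (z (Fin.last 1))) hMn hMn2 hem
  have hFU' : ∀ z, FU' z =
      ∑ m ∈ Finset.range (n + 1), cL' m (Fin.init z) * kernel m 1 (κ₀ (Fin.init z)) (z (Fin.last 1)) +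
      ∑ m ∈ Finset.range (2 * n + 2),
        cA' m (Fin.init z) * kernel m 2 (κ₀ (Fin.init z)) (z (Fin.last 1)) := fun z => by
    simp only [hFU'_def, hcL'_def, hcA'_def]
    exact sum_regroup₂ M' e' (fun j => h' j (Fin.init z))
      (fun m d => kernel m d (κ₀ (Fin.init z)) (z (Fin.last 1))) hM'n hM'n2 hem'
  have hell : ∀ x, ∑ i, h i x * ell (M i) (e i) (κ₀ x) =
      ∑ m ∈ Finset.range (n + 1), cL m x * ell m 1 (κ₀ x) +
      ∑ m ∈ Finset.range (2 * n + 2), cA m x * ell m 2 (κ₀ x) := fun x => by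
    simp only [hcL_def, hcA_def]
    exact sum_regroup₂ M e (fun i => h i x) (fun m d => ell m d (κ₀ x)) hMn hMn2 hem
  have hell' : ∀ x, ∑ j, h' j x * ell (M' j) (e' j) (κ₀ x) =
      ∑ m ∈ Finset.range (n + 1), cL' m x * ell m 1 (κ₀ x) +
      ∑ m ∈ Finset.range (2 * n + 2), cA' m x * ell m 2 (κ₀ x) := fun x => by
    simp only [hcL'_def, hcA'_def]
    exact sum_regroup₂ M' e' (fun j => h' j x) (fun m d => ell m d (κ₀ x)) hM'n hM'n2 hem'
  have e1 : ∀ x i, h i x * ell (M i) (e i) (κ i x) = h i x * ell (M i) (e i) (κ₀ x) := fun x i => by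
    rw [hκκ i]
  have e1' : ∀ x j, h' j x * ell (M' j) (e' j) (κ' j x) = h' j x * ell (M' j) (e' j) (κ₀ x) :=
    fun x j => by rw [hκκ' j]
  -- the monomials in `κ₀`-form
  have hcyl : IsSemialgebraic ℚ (RTerm.cyl g.domain) := RTerm.isSemialgebraic_cyl hG
  have hcyl' : IsSemialgebraic ℚ (RTerm.cyl g'.domain) := RTerm.isSemialgebraic_cyl hG'
  have hcylm : MeasurableSet (RTerm.cyl g.domain) := hcyl.measurableSet_holds
  have hcylm' : MeasurableSet (RTerm.cyl g'.domain) := hcyl'.measurableSet_holds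
  have hUpt : ∀ i, ∀ z ∈ RTerm.cyl g.domain,
      (U i).integrand z = h i (Fin.init z) * kernel (M i) (e i) (κ₀ (Fin.init z)) (z (Fin.last 1)) := by
    intro i z hz
    rw [hint i (by rw [hdom i]; exact hz), hκκ i]
    simp [kernel]
  have hU'pt : ∀ j, ∀ z ∈ RTerm.cyl g'.domain,
      (U' j).integrand z =
        h' j (Fin.init z) * kernel (M' j) (e' j) (κ₀ (Fin.init z)) (z (Fin.last 1)) := by
    intro j z hz
    rw [hint' j (by rw [hdom' j]; exact hz), hκκ' j]
    simp [kernel]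
  have hU_sa : ∀ i, IsSemialgebraicFunOn ℚ (RTerm.cyl g.domain)
      (fun z => h i (Fin.init z) * kernel (M i) (e i) (κ₀ (Fin.init z)) (z (Fin.last 1))) := by
    intro i
    have h1 := (U i).isSemialgebraicFunOn_integrand
    rw [hdom i] at h1
    exact h1.congr fun z hz => hUpt i z hz
  have hU'_sa : ∀ j, IsSemialgebraicFunOn ℚ (RTerm.cyl g'.domain)
      (fun z => h' j (Fin.init z) * kernel (M' j) (e' j) (κ₀ (Fin.init z)) (z (Fin.last 1))) := by
    intro j
    have h1 := (U' j).isSemialgebraicFunOn_integrand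
    rw [hdom' j] at h1
    exact h1.congr fun z hz => hU'pt j z hz
  have hU_int : ∀ i, IntegrableOn
      (fun z => h i (Fin.init z) * kernel (M i) (e i) (κ₀ (Fin.init z)) (z (Fin.last 1)))
      (RTerm.cyl g.domain) := by
    intro i
    have h1 := (U i).integrableOn
    rw [hdom i] at h1
    exact h1.congr_fun (fun z hz => hUpt i z hz) hcylm
  have hU'_int : ∀ j, IntegrableOn
      (fun z => h' j (Fin.init z) * kernel (M' j) (e' j) (κ₀ (Fin.init z)) (z (Fin.last 1)))
      (RTerm.cyl g'.domain) := by
    intro j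
    have h1 := (U' j).integrableOn
    rw [hdom' j] at h1
    exact h1.congr_fun (fun z hz => hU'pt j z hz) hcylm'
  -- integrability of the regrouped arctan-kind monomials (finite sums of the given ones)
  have hcoef_int : ∀ {S : Set (Fin 1 → ℝ)} {q : ℕ} (N E : Fin q → ℕ) (u : Fin q → (Fin 1 → ℝ) → ℝ)
      (hu : ∀ i, IntegrableOn
        (fun z => u i (Fin.init z) * kernel (N i) (E i) (κ₀ (Fin.init z)) (z (Fin.last 1)))
        (RTerm.cyl S)) (m d : ℕ),
      IntegrableOn (fun z : Fin (1 + 1) → ℝ =>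
        (∑ i, if N i = m then (if E i = d then u i (Fin.init z) else 0) else 0) *
          kernel m d (κ₀ (Fin.init z)) (z (Fin.last 1))) (RTerm.cyl S) := by
    intro S q N E u hu m d
    simp only [Finset.sum_mul]
    refine integrable_finsetSum _ fun i _ => ?_
    by_cases hi : N i = m
    · by_cases hei : E i = d
      · have h1 := hu i
        rw [hi, hei] at h1
        simp only [hi, hei, if_true]
        exact h1
      · simp only [hi, hei, if_true, if_false, zero_mul]
        exact integrable_zero _ _ _
    · simp only [hi, if_false, zero_mul]
      exact integrable_zero _ _ _
  have hcA_int : ∀ m, IntegrableOn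
      (fun z => cA m (Fin.init z) * kernel m 2 (κ₀ (Fin.init z)) (z (Fin.last 1)))
      (RTerm.cyl g.domain) := fun m => by
    simp only [hcA_def]
    exact hcoef_int M e h hU_int m 2
  have hcA'_int : ∀ m, IntegrableOn
      (fun z => cA' m (Fin.init z) * kernel m 2 (κ₀ (Fin.init z)) (z (Fin.last 1)))
      (RTerm.cyl g'.domain) := fun m => by
    simp only [hcA'_def]
    exact hcoef_int M' e' h' hU'_int m 2
  -- the unfolded bases and the collapsed representations `V`, `V'`
  have hg_sa : IsSemialgebraicFunOn ℚ (RTerm.cyl g.domain) (fun z => g.integrand (Fin.init z)) :=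
    g.isSemialgebraicFunOn_integrand.comp_init_mono hcyl fun z hz => hz.1
  have hg'_sa : IsSemialgebraicFunOn ℚ (RTerm.cyl g'.domain) (fun z => g'.integrand (Fin.init z)) :=
    g'.isSemialgebraicFunOn_integrand.comp_init_mono hcyl' fun z hz => hz.1
  have hg_int : IntegrableOn (fun z : Fin (1 + 1) → ℝ => g.integrand (Fin.init z))
      (RTerm.cyl g.domain) := by
    have := integrableOn_cyl_polynomial hG (m := 0) (a := fun _ => g.integrand)
      (fun _ => g.isSemialgebraicFunOn_integrand) (fun _ => g.integrableOn)
    exact this.congr_fun (fun z _ => by simp) hcylm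
  have hg'_int : IntegrableOn (fun z : Fin (1 + 1) → ℝ => g'.integrand (Fin.init z))
      (RTerm.cyl g'.domain) := by
    have := integrableOn_cyl_polynomial hG' (m := 0) (a := fun _ => g'.integrand)
      (fun _ => g'.isSemialgebraicFunOn_integrand) (fun _ => g'.integrableOn)
    exact this.congr_fun (fun z _ => by simp) hcylm'
  let B₀ : KZ.IntegralRep (1 + 1) :=
    ⟨RTerm.cyl g.domain, fun z => g.integrand (Fin.init z), hcyl, hg_sa, hg_int⟩
  let B₀' : KZ.IntegralRep (1 + 1) :=
    ⟨RTerm.cyl g'.domain, fun z => g'.integrand (Fin.init z), hcyl', hg'_sa, hg'_int⟩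
  have hFU_sa : IsSemialgebraicFunOn ℚ (RTerm.cyl g.domain) FU := by
    simp only [hFU_def]
    exact isSemialgebraicFunOn_finset_sum hcyl _ fun i _ => hU_sa i
  have hFU'_sa : IsSemialgebraicFunOn ℚ (RTerm.cyl g'.domain) FU' := by
    simp only [hFU'_def]
    exact isSemialgebraicFunOn_finset_sum hcyl' _ fun j _ => hU'_sa j
  have hFU_int : IntegrableOn FU (RTerm.cyl g.domain) := by
    simp only [hFU_def]
    exact integrable_finsetSum _ fun i _ => hU_int i
  have hFU'_int : IntegrableOn FU' (RTerm.cyl g'.domain) := by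
    simp only [hFU'_def]
    exact integrable_finsetSum _ fun j _ => hU'_int j
  let V : KZ.IntegralRep (1 + 1) :=
    ⟨RTerm.cyl g.domain, fun z => g.integrand (Fin.init z) + FU z, hcyl,
      IsSemialgebraicFunOn.add_holds hg_sa hFU_sa, hg_int.add hFU_int⟩
  let V' : KZ.IntegralRep (1 + 1) :=
    ⟨RTerm.cyl g'.domain, fun z => g'.integrand (Fin.init z) + FU' z, hcyl',
      IsSemialgebraicFunOn.add_holds hg'_sa hFU'_sa, hg'_int.add hFU'_int⟩
  -- (A) collapse: `[V] ≡ [B₀] + Σ [Uᵢ]`, `[B₀] ≡ [g]`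
  have hA : KZ.of V - KZ.of B₀ - ∑ i, KZ.of (U i) ∈ KZ.relations := by
    refine of_sub_sub_sum_mem_relations k V B₀ U rfl (fun i => hdom i) fun z hz => ?_
    show g.integrand (Fin.init z) + FU z = g.integrand (Fin.init z) + ∑ i, (U i).integrand z
    simp only [hFU_def]
    congr 1
    exact Finset.sum_congr rfl fun i _ => (hUpt i z hz).symm
  have hA' : KZ.of V' - KZ.of B₀' - ∑ j, KZ.of (U' j) ∈ KZ.relations := by
    refine of_sub_sub_sum_mem_relations k' V' B₀' U' rfl (fun j => hdom' j) fun z hz => ?_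
    show g'.integrand (Fin.init z) + FU' z = g'.integrand (Fin.init z) + ∑ j, (U' j).integrand z
    simp only [hFU'_def]
    congr 1
    exact Finset.sum_congr rfl fun j _ => (hU'pt j z hz).symm
  have hB₀ : KZ.of B₀ - KZ.of g ∈ KZ.relations := by
    obtain ⟨hTb, hfold⟩ := foldsTo_cyl_polynomial B₀ hG (m := 0) (a := fun _ => g.integrand)
      (fun _ => g.isSemialgebraicFunOn_integrand) rfl (fun z _ => by
        show g.integrand (Fin.init z) = _
        simp)
    have h1 : KZ.of B₀ - KZ.of (RTerm.baseRep _ hTb) ∈ KZ.relations := by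
      have := hfold.1
      rwa [RTerm.unfold_base] at this
    have h2 : KZ.of (RTerm.baseRep _ hTb) - KZ.of g ∈ KZ.relations := by
      refine AECongr.of_sub_of_mem_relations_of_indicator_ae _ g (ae_of_all _ fun x => ?_)
      show g.domain.indicator (fun x => ∑ k : Fin (0 + 1), g.integrand x / ((k : ℕ) + 1)) x =
        g.domain.indicator g.integrand x
      congr 1
      funext y
      simp
    have e : KZ.of B₀ - KZ.of g = (KZ.of B₀ - KZ.of (RTerm.baseRep _ hTb)) +
        (KZ.of (RTerm.baseRep _ hTb) - KZ.of g) := by abel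
    rw [e]
    exact add_mem h1 h2
  have hB₀' : KZ.of B₀' - KZ.of g' ∈ KZ.relations := by
    obtain ⟨hTb, hfold⟩ := foldsTo_cyl_polynomial B₀' hG' (m := 0) (a := fun _ => g'.integrand)
      (fun _ => g'.isSemialgebraicFunOn_integrand) rfl (fun z _ => by
        show g'.integrand (Fin.init z) = _
        simp)
    have h1 : KZ.of B₀' - KZ.of (RTerm.baseRep _ hTb) ∈ KZ.relations := by
      have := hfold.1
      rwa [RTerm.unfold_base] at this
    have h2 : KZ.of (RTerm.baseRep _ hTb) - KZ.of g' ∈ KZ.relations := by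
      refine AECongr.of_sub_of_mem_relations_of_indicator_ae _ g' (ae_of_all _ fun x => ?_)
      show g'.domain.indicator (fun x => ∑ k : Fin (0 + 1), g'.integrand x / ((k : ℕ) + 1)) x =
        g'.domain.indicator g'.integrand x
      congr 1
      funext y
      simp
    have e : KZ.of B₀' - KZ.of g' = (KZ.of B₀' - KZ.of (RTerm.baseRep _ hTb)) +
        (KZ.of (RTerm.baseRep _ hTb) - KZ.of g') := by abel
    rw [e]
    exact add_mem h1 h2
  -- (B) domain splits along `G ∩ G'`, `G ∖ G'`, `G' ∖ G`
  have hIsub : RTerm.cyl (g.domain ∩ g'.domain) ⊆ RTerm.cyl g.domain := fun z hz => ⟨hz.1.1, hz.2⟩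
  have hIsub' : RTerm.cyl (g.domain ∩ g'.domain) ⊆ RTerm.cyl g'.domain := fun z hz => ⟨hz.1.2, hz.2⟩
  have hDsub : RTerm.cyl (g.domain \ g'.domain) ⊆ RTerm.cyl g.domain := fun z hz => ⟨hz.1.1, hz.2⟩
  have hD'sub : RTerm.cyl (g'.domain \ g.domain) ⊆ RTerm.cyl g'.domain := fun z hz => ⟨hz.1.1, hz.2⟩
  have hcI : IsSemialgebraic ℚ (RTerm.cyl (g.domain ∩ g'.domain)) := RTerm.isSemialgebraic_cyl hIs
  have hcD : IsSemialgebraic ℚ (RTerm.cyl (g.domain \ g'.domain)) := RTerm.isSemialgebraic_cyl hDs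
  have hcD' : IsSemialgebraic ℚ (RTerm.cyl (g'.domain \ g.domain)) := RTerm.isSemialgebraic_cyl hD's
  let V₁ : KZ.IntegralRep (1 + 1) := V.restrict _ hcI hIsub
  let V₂ : KZ.IntegralRep (1 + 1) := V.restrict _ hcD hDsub
  let V'₁ : KZ.IntegralRep (1 + 1) := V'.restrict _ hcI hIsub'
  let V'₂ : KZ.IntegralRep (1 + 1) := V'.restrict _ hcD' hD'sub
  have hS : KZ.of V - KZ.of V₁ - KZ.of V₂ ∈ KZ.relations := by
    refine KZ.domainAddRel_subset_relations ⟨_, V, V₁, V₂, ?_, ?_, fun _ _ => rfl, fun _ _ => rfl, rfl⟩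
    · show RTerm.cyl g.domain =
        RTerm.cyl (g.domain ∩ g'.domain) ∪ RTerm.cyl (g.domain \ g'.domain)
      ext z
      simp only [RTerm.cyl, mem_setOf_eq, mem_union, mem_inter_iff, Set.mem_sdiff]
      tauto
    · show volume (RTerm.cyl (g.domain ∩ g'.domain) ∩ RTerm.cyl (g.domain \ g'.domain)) = 0
      have h0 : RTerm.cyl (g.domain ∩ g'.domain) ∩ RTerm.cyl (g.domain \ g'.domain) = ∅ := by
        ext z
        simp only [RTerm.cyl, mem_setOf_eq, mem_inter_iff, Set.mem_sdiff, mem_empty_iff_false, iff_false]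
        tauto
      rw [h0, measure_empty]
  have hS' : KZ.of V' - KZ.of V'₁ - KZ.of V'₂ ∈ KZ.relations := by
    refine KZ.domainAddRel_subset_relations
      ⟨_, V', V'₁, V'₂, ?_, ?_, fun _ _ => rfl, fun _ _ => rfl, rfl⟩
    · show RTerm.cyl g'.domain =
        RTerm.cyl (g.domain ∩ g'.domain) ∪ RTerm.cyl (g'.domain \ g.domain)
      ext z
      simp only [RTerm.cyl, mem_setOf_eq, mem_union, mem_inter_iff, Set.mem_sdiff]
      tauto
    · show volume (RTerm.cyl (g.domain ∩ g'.domain) ∩ RTerm.cyl (g'.domain \ g.domain)) = 0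
      have h0 : RTerm.cyl (g.domain ∩ g'.domain) ∩ RTerm.cyl (g'.domain \ g.domain) = ∅ := by
        ext z
        simp only [RTerm.cyl, mem_setOf_eq, mem_inter_iff, Set.mem_sdiff, mem_empty_iff_false, iff_false]
        tauto
      rw [h0, measure_empty]
  -- (C) subtraction on the common piece
  let W : KZ.IntegralRep (1 + 1) :=
    ⟨RTerm.cyl (g.domain ∩ g'.domain), fun z => V.integrand z - V'.integrand z, hcI,
      IsSemialgebraicFunOn.sub_holds (V.isSemialgebraicFunOn_integrand.mono hIsub hcI)
        (V'.isSemialgebraicFunOn_integrand.mono hIsub' hcI),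
      (V.integrableOn.mono_set hIsub).sub (V'.integrableOn.mono_set hIsub')⟩
  have hW3 : KZ.of V₁ - KZ.of V'₁ - KZ.of W ∈ KZ.relations := by
    refine KZ.integrandAddRel_subset_relations ⟨_, V₁, V'₁, W, rfl, rfl, fun z _ => ?_, rfl⟩
    show V.integrand z = V'.integrand z + (V.integrand z - V'.integrand z)
    ring
  -- (D) the three pieces are relations (the mixed core lemma)
  have hW : KZ.of W ∈ KZ.relations := by
    refine cyl_commonMixed_mem_relations hIs W n (a₀ := fun x => g.integrand x - g'.integrand x)
      (κ := κ₀) (c₁ := fun m x => cL m x - cL' m x) (c₂ := fun m x => cA m x - cA' m x)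
      (IsSemialgebraicFunOn.sub_holds (g.isSemialgebraicFunOn_integrand.mono inter_subset_left hIs)
        (g'.isSemialgebraicFunOn_integrand.mono inter_subset_right hIs))
      (hκ₀G.mono inter_subset_left hIs)
      (fun m => IsSemialgebraicFunOn.sub_holds ((hcL m).mono inter_subset_left hIs)
        ((hcL' m).mono inter_subset_right hIs))
      (fun m => IsSemialgebraicFunOn.sub_holds ((hcA m).mono inter_subset_left hIs)
        ((hcA' m).mono inter_subset_right hIs))
      (fun x hx => hκ₀0 x (Or.inl hx.1)) rfl (fun z _ => ?_) ?_ ?_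
    · show (g.integrand (Fin.init z) + FU z) - (g'.integrand (Fin.init z) + FU' z) =
        (g.integrand (Fin.init z) - g'.integrand (Fin.init z)) +
          ∑ m ∈ Finset.range (n + 1),
            (cL m (Fin.init z) - cL' m (Fin.init z)) * kernel m 1 (κ₀ (Fin.init z)) (z (Fin.last 1)) +
          ∑ m ∈ Finset.range (2 * n + 2),
            (cA m (Fin.init z) - cA' m (Fin.init z)) * kernel m 2 (κ₀ (Fin.init z)) (z (Fin.last 1))
      rw [hFU z, hFU' z]
      simp only [sub_mul, Finset.sum_sub_distrib]
      ring
    · refine integrable_finsetSum _ fun j _ => ?_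
      have h1 := ((hcA_int (2 * j + 1)).mono_set hIsub).sub ((hcA'_int (2 * j + 1)).mono_set hIsub')
      exact h1.congr_fun (fun z _ => by simp only [Pi.sub_apply]; ring) hcI.measurableSet_holds
    · filter_upwards [hae] with x hx hxI
      simp only [indicator_of_mem hxI.1, indicator_of_mem hxI.2] at hx
      have hx' : g.integrand x + ∑ i, h i x * ell (M i) (e i) (κ i x) =
          g'.integrand x + ∑ j, h' j x * ell (M' j) (e' j) (κ' j x) := hx
      simp only [e1, e1', hell, hell'] at hx'
      show (g.integrand x - g'.integrand x) +
          ∑ m ∈ Finset.range (n + 1), (cL m x - cL' m x) * ell m 1 (κ₀ x) +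
          ∑ m ∈ Finset.range (2 * n + 2), (cA m x - cA' m x) * ell m 2 (κ₀ x) = 0
      simp only [sub_mul, Finset.sum_sub_distrib]
      linarith
  have hV₂ : KZ.of V₂ ∈ KZ.relations := by
    refine cyl_commonMixed_mem_relations hDs V₂ n (a₀ := g.integrand) (κ := κ₀) (c₁ := cL) (c₂ := cA)
      (g.isSemialgebraicFunOn_integrand.mono (fun x hx => hx.1) hDs) (hκ₀G.mono (fun x hx => hx.1) hDs)
      (fun m => (hcL m).mono (fun x hx => hx.1) hDs) (fun m => (hcA m).mono (fun x hx => hx.1) hDs)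
      (fun x hx => hκ₀0 x (Or.inl hx.1)) rfl (fun z _ => ?_) ?_ ?_
    · show g.integrand (Fin.init z) + FU z = g.integrand (Fin.init z) +
        ∑ m ∈ Finset.range (n + 1), cL m (Fin.init z) * kernel m 1 (κ₀ (Fin.init z)) (z (Fin.last 1)) +
        ∑ m ∈ Finset.range (2 * n + 2), cA m (Fin.init z) * kernel m 2 (κ₀ (Fin.init z)) (z (Fin.last 1))
      rw [hFU z]
      ring
    · exact integrable_finsetSum _ fun j _ => (hcA_int (2 * j + 1)).mono_set hDsub
    · filter_upwards [hae] with x hx hxD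
      simp only [indicator_of_mem hxD.1, indicator_of_notMem hxD.2] at hx
      have hx' : g.integrand x + ∑ i, h i x * ell (M i) (e i) (κ i x) = 0 := hx
      simp only [e1, hell] at hx'
      linarith
  have hV'₂ : KZ.of V'₂ ∈ KZ.relations := by
    refine cyl_commonMixed_mem_relations hD's V'₂ n (a₀ := g'.integrand) (κ := κ₀) (c₁ := cL')
      (c₂ := cA')
      (g'.isSemialgebraicFunOn_integrand.mono (fun x hx => hx.1) hD's) (hκ₀G'.mono (fun x hx => hx.1) hD's)
      (fun m => (hcL' m).mono (fun x hx => hx.1) hD's) (fun m => (hcA' m).mono (fun x hx => hx.1) hD's)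
      (fun x hx => hκ₀0 x (Or.inr hx.1)) rfl (fun z _ => ?_) ?_ ?_
    · show g'.integrand (Fin.init z) + FU' z = g'.integrand (Fin.init z) +
        ∑ m ∈ Finset.range (n + 1), cL' m (Fin.init z) * kernel m 1 (κ₀ (Fin.init z)) (z (Fin.last 1)) +
        ∑ m ∈ Finset.range (2 * n + 2), cA' m (Fin.init z) * kernel m 2 (κ₀ (Fin.init z)) (z (Fin.last 1))
      rw [hFU' z]
      ring
    · exact integrable_finsetSum _ fun j _ => (hcA'_int (2 * j + 1)).mono_set hD'sub
    · filter_upwards [hae] with x hx hxD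
      simp only [indicator_of_notMem hxD.2, indicator_of_mem hxD.1] at hx
      have hx' : 0 = g'.integrand x + ∑ j, h' j x * ell (M' j) (e' j) (κ' j x) := hx
      simp only [e1', hell'] at hx'
      linarith
  -- (E) assemble
  have eq : (KZ.of g + ∑ i, KZ.of (U i)) - (KZ.of g' + ∑ j, KZ.of (U' j)) =
      -(KZ.of V - KZ.of B₀ - ∑ i, KZ.of (U i)) - (KZ.of B₀ - KZ.of g)
      + (KZ.of V' - KZ.of B₀' - ∑ j, KZ.of (U' j)) + (KZ.of B₀' - KZ.of g')
      + (KZ.of V - KZ.of V₁ - KZ.of V₂) - (KZ.of V' - KZ.of V'₁ - KZ.of V'₂)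
      + (KZ.of V₁ - KZ.of V'₁ - KZ.of W) + KZ.of W + KZ.of V₂ - KZ.of V'₂ := by
    abel
  rw [eq]
  exact sub_mem (add_mem (add_mem (add_mem (sub_mem (add_mem (add_mem (add_mem (sub_mem
    (neg_mem hA) hB₀) hA') hB₀') hS) hS') hW3) hW) hV₂) hV'₂

end CommonPosRung

end RegularisedLogLayer

end Summit.KontsevichZagierPeriods.RootDecompRelativeModAbsolute.Rung30571

end
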